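import Mathlib
import Summits.ValiantsHypothesis.ValiantsHypothesis.Theorems.ValuativeGCTValuativeFlipTwoRowValues
import Summits.ValiantsHypothesis.ValiantsHypothesis.Theorems.ValuativeGCTValuativeFlipSemigroupFloor

/-!
# Explicit two-row highest-weight vectors, IV: the seeds in `ℂ[Δ_m(X₀₀^{m-n} per_n)]`
# (crux `ValuativeGCT.ValuativeFlip`, stmt-ValiantsHypothesis-12624; wall-breaker axis k13
# "explicit padded-permanent highest-weight vectors for seedRichness", part E — the deliverable)

Composition of parts A–D: the classes `[F_0], [F_2], …, [F_{n-1}]` of the explicit two-row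
highest-weight vectors in the coordinate ring `OrbitCoordRing (paddedPerFormLex ℂ n m) m` of the orbit
closure of the padded permanent are highest-weight vectors (`mk_twoRowHWV_mem_highestWeightSpace`) and
ALGEBRAICALLY INDEPENDENT for all `3 ≤ n ≤ m` (`algebraicIndependent_mk_twoRowHWV`: their values along
the singular pencil `A(a)` are the algebraically independent value polynomials, and
`algebraicIndependent_mk_of_points` transfers this through `I(GL · pp) = ker genericOrbitMap`).  The
monomials `Q_j = [F_0]^{L/2 - L/j} [F_j]^{L/j}` (`2 ≤ j ≤ n-1`, `L = (n-1)!`) then form `n - 2`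
algebraically independent highest-weight vectors of ONE explicit weight `seedWeight n m`
(`twoRow_sameWeight_seeds`, via `algebraicIndependent_monomial`), uniformly in `m ≥ n`:
`paddedPer_explicit_twoRow_seedRichness` has the shape of the registered `stub_seedRichness` of line
`big-cell-semigroup-floor` with its richness `n⁴/4 ≤ D` replaced by the two-row richness `D + 3 = n` —
the first certified, `m`-uniform, same-weight algebraically independent seed family of the padded
permanent in the tree (feeding the landed engine `semigroupFloor`:
`orbitMultiplicity ℂ (paddedPerFormLex ℂ n m) m (k • seedWeight n m) ≥ C(k + n - 3, n - 3)`).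
Why only `Θ(n)`: two-row seeds are functions on the `(n+2)`-dimensional variety of binary restrictions
`ℓ^{m-n} q`; richness `n⁴/4` needs semi-invariants on `≈ 0.29 n²` letters (AXIS.md of the seat).

Sources: folklore; the seat's parts A–D.
-/

set_option linter.dupNamespace false

namespace Summit.ValiantsHypothesis.ValiantsHypothesis.Theorems.ValuativeFlip

open MvPolynomial
open scoped BigOperators

noncomputable section

/-! ## Part E — the seeds in `ℂ[Δ_m(X₀₀^{m-n} per_n)]`: algebraic independence of the classes, and a
same-weight family (seed richness `n - 2` at an explicit two-row weight, uniformly in `m ≥ n`) -/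

section Seeds

open Literature.NumberTheory.DiophantineGeometry Literature.Computability.AlgebraicComplexity
  Literature.Barriers.ValiantsHypothesis Literature.Computability.Complexity

variable {n m : ℕ}

/-- **The classes of the explicit two-row highest-weight vectors `F_0, F_2, …, F_{n-1}` are
algebraically independent in `ℂ[Δ_m(X₀₀^{m-n} per_n)]`** for `3 ≤ n ≤ m`: their values along the
singular pencil `A(a)` are the algebraically independent value polynomials `G_j(a)`
(`algebraicIndependent_mk_of_points`, `aeval_formCoeff_pencil_twoRowHWV`,
`algebraicIndependent_pencilValue_seed`). [folklore] -/
theorem algebraicIndependent_mk_twoRowHWV [NeZero n] [NeZero m] (hn : 3 ≤ n) (hnm : n ≤ m)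
    (hm : 2 ≤ m) :
    AlgebraicIndependent ℂ fun i : Fin (n - 1) =>
      (Ideal.Quotient.mk (orbitVanishingIdeal (paddedPerFormLex ℂ n m) m) (twoRowHWV m hm (seedIdx i)) :
        OrbitCoordRing (paddedPerFormLex ℂ n m) m) :=
  algebraicIndependent_mk_of_points (paddedPerFormLex ℂ n m) m
    (fun i : Fin (n - 1) => twoRowHWV m hm (seedIdx i))
    (fun i : Fin (n - 1) => pencilValue n m (seedIdx i)) (algebraicIndependent_pencilValue_seed hn hnm)
    (fun a : BlockIdx n m → ℂ => pencilMat hm a)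
    fun a i => aeval_formCoeff_pencil_twoRowHWV hnm hm (seedIdx i) a

/-- The classes `[F_j]` are highest-weight vectors of `ℂ[Δ_m(X₀₀^{m-n} per_n)]` of weight
`twoRowWeight m hm j` (`j ≤ m`). [folklore] -/
theorem mk_twoRowHWV_mem_highestWeightSpace [NeZero m] (hm : 2 ≤ m) {j : ℕ} (hj : j ≤ m) (n : ℕ) :
    (Ideal.Quotient.mk (orbitVanishingIdeal (paddedPerFormLex ℂ n m) m) (twoRowHWV m hm j) :
        OrbitCoordRing (paddedPerFormLex ℂ n m) m) ∈
      highestWeightSpace (orbitCoordRep (paddedPerFormLex ℂ n m) m) (twoRowWeight m hm j) :=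
  mk_mem_highestWeightSpace_orbitCoordRep _ m (twoRowHWV_mem_highestWeightSpace hm hj)

/-- Powers of highest-weight vectors of an orbit-closure coordinate ring. [folklore] -/
theorem pow_mem_highestWeightSpace_orbitCoordRep {σ : Type*} [Fintype σ] [LinearOrder σ]
    (f : MvPolynomial σ ℂ) (m : ℕ) {χ : Weight σ} {x : OrbitCoordRing f m}
    (hx : x ∈ highestWeightSpace (orbitCoordRep f m) χ) (k : ℕ) :
    x ^ k ∈ highestWeightSpace (orbitCoordRep f m) (k • χ) := by
  induction k with
  | zero =>
    rw [pow_zero, zero_smul]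
    intro g _
    rw [orbitCoordRep_apply, map_one]
    simp [weightChar]
  | succ k ih =>
    rw [pow_succ, succ_nsmul]
    exact mul_mem_highestWeightSpace_orbitCoordRep f m ih hx

/-! ### The same-weight seeds `Q_j = F_0^{L/2 - L/j} · F_j^{L/j}`, `2 ≤ j ≤ n - 1` -/

/-- The common multiple `L = (n-1)!` of the seed indices `2, …, n-1`. [folklore] -/
def seedL (n : ℕ) : ℕ := (n - 1).factorial

/-- Every seed index divides `L`. [folklore] -/
theorem dvd_seedL {j : ℕ} (hj1 : 1 ≤ j) (hjn : j ≤ n - 1) : j ∣ seedL n :=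
  Nat.dvd_factorial hj1 hjn

/-- `L > 0`. [folklore] -/
theorem seedL_pos : 0 < seedL n := Nat.factorial_pos _

/-- The common weight `ν` of the seeds on the two letters: `(-L, -((L/2)·m + L·(m-1)))`. [folklore] -/
def seedWeight₂ (n m : ℕ) : Weight (Fin 2) :=
  fun a => if a = 0 then -(seedL n : ℤ) else -(((seedL n / 2) * m + seedL n * (m - 1) : ℕ) : ℤ)

/-- The common weight of the seeds, on the last two letters of `MatIdx m`. [folklore] -/
def seedWeight (n m : ℕ) (hm : 2 ≤ m) : Weight (MatIdx m) :=
  Function.extend (lastTwo hm) (seedWeight₂ n m) 0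

/-- **Weight bookkeeping**: `(L/2 - L/j) · wt(F_0) + (L/j) · wt(F_j) = ν` for `2 ≤ j ≤ n-1`.
[folklore] -/
theorem seed_weight_eq (hm : 2 ≤ m) {j : ℕ} (hj2 : 2 ≤ j) (hjn : j ≤ n - 1) :
    (seedL n / 2 - seedL n / j) • twoRowWeight m hm 0 + (seedL n / j) • twoRowWeight m hm j =
      seedWeight n m hm := by
  have hdvd : j ∣ seedL n := dvd_seedL (by omega) hjn
  have hdvd2 : 2 ∣ seedL n := dvd_seedL (by omega) (by omega)
  have hle : seedL n / j ≤ seedL n / 2 := Nat.div_le_div_left hj2 (by omega)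
  have hmul : seedL n / j * j = seedL n := Nat.div_mul_cancel hdvd
  funext x
  simp only [Pi.add_apply, Pi.smul_apply, twoRowWeight, seedWeight]
  by_cases hx : x ∈ Set.range (lastTwo hm)
  · obtain ⟨a, rfl⟩ := hx
    rw [(lastTwo_strictMono hm).injective.extend_apply, (lastTwo_strictMono hm).injective.extend_apply,
      (lastTwo_strictMono hm).injective.extend_apply]
    fin_cases a
    · simp only [protoWeight, seedWeight₂, Fin.zero_eta, Fin.isValue, if_true, Nat.cast_zero, neg_zero,
        smul_zero, zero_add, smul_neg, nsmul_eq_mul]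
      rw [← Nat.cast_mul, hmul]
    · simp only [protoWeight, seedWeight₂, Fin.mk_one, Fin.isValue, one_ne_zero, if_false, zero_mul,
        add_zero, smul_neg, nsmul_eq_mul]
      rw [← neg_add, ← Nat.cast_mul, ← Nat.cast_mul, ← Nat.cast_add]
      congr 2
      have h1 : seedL n / j * (m + j * (m - 1)) = seedL n / j * m + seedL n * (m - 1) := by
        rw [mul_add, ← mul_assoc, hmul]
      rw [h1]
      have h2 : (seedL n / 2 - seedL n / j) * m + seedL n / j * m = seedL n / 2 * m := by
        rw [← add_mul, Nat.sub_add_cancel hle]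
      omega
  · rw [Function.extend_apply' _ _ _ (fun ⟨a, ha⟩ => hx ⟨a, ha⟩),
      Function.extend_apply' _ _ _ (fun ⟨a, ha⟩ => hx ⟨a, ha⟩),
      Function.extend_apply' _ _ _ (fun ⟨a, ha⟩ => hx ⟨a, ha⟩)]
    simp

/-- The exponent vector of the seed `Q_{k+2} = F_0^{L/2 - L/(k+2)} F_{k+2}^{L/(k+2)}` on the independent
family `(F_{seedIdx i})_{i < n-1}` (`F_{k+2} = F_{seedIdx (k+1)}`). [folklore] -/
def seedExp (n : ℕ) (k : Fin (n - 2)) : Fin (n - 1) →₀ ℕ :=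
  Finsupp.single ⟨0, by have := k.2; omega⟩ (seedL n / 2 - seedL n / (k + 2)) +
    Finsupp.single ⟨k + 1, by have := k.2; omega⟩ (seedL n / (k + 2))

/-- The exponent vector of the seed `Q_{k'+2}` at the private letter `F_{k+2}` of the seed `Q_{k+2}`.
[folklore] -/
theorem seedExp_apply_succ (k k' : Fin (n - 2)) :
    seedExp n k' ⟨k + 1, by have := k.2; omega⟩ = if k' = k then seedL n / (k + 2) else 0 := by
  simp only [seedExp, Finsupp.coe_add, Pi.add_apply, Finsupp.single_apply, Fin.mk.injEq]
  rw [if_neg (by omega)]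
  by_cases h : k' = k
  · subst h
    rw [if_pos rfl, if_pos rfl, zero_add]
  · have hne : (k' : ℕ) + 1 ≠ k + 1 := fun e => h (Fin.ext (by omega))
    rw [if_neg hne, if_neg h, zero_add]

/-- The exponent map of the seeds is injective on `ℕ`-combinations (each seed has a private letter
`F_{k+2}` with a positive exponent). [folklore] -/
theorem seedExp_sum_injective (hn : 3 ≤ n) :
    Function.Injective fun c : Fin (n - 2) →₀ ℕ => c.sum fun k e => e • seedExp n k := by
  intro c c' h
  ext k
  have hk := k.2
  have hpos : 0 < seedL n / (k + 2) :=
    Nat.div_pos (Nat.le_of_dvd seedL_pos (dvd_seedL (by omega) (by omega))) (by omega)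
  -- read the coefficient of the private letter `k + 1`
  have key : ∀ c : Fin (n - 2) →₀ ℕ,
      (c.sum fun k e => e • seedExp n k) ⟨k + 1, by omega⟩ = c k * (seedL n / (k + 2)) := by
    intro c
    rw [Finsupp.sum_apply, Finsupp.sum, Finset.sum_eq_single k]
    · rw [Finsupp.smul_apply, seedExp_apply_succ, if_pos rfl, smul_eq_mul]
    · intro k' _ hk'
      rw [Finsupp.smul_apply, seedExp_apply_succ, if_neg hk', smul_zero]
    · intro hk
      rw [Finsupp.notMem_support_iff.mp hk, zero_smul, Finsupp.coe_zero, Pi.zero_apply]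
  have h1 := congrArg (fun v : Fin (n - 1) →₀ ℕ => v ⟨k + 1, by omega⟩) h
  simp only [key] at h1
  exact Nat.eq_of_mul_eq_mul_right hpos h1

/-- **Explicit seed richness `n - 2` at one weight, uniformly in `m ≥ n`.**  For `3 ≤ n ≤ m` the
`n - 2` elements `Q_j = [F_0]^{L/2 - L/j} [F_j]^{L/j}` (`2 ≤ j ≤ n-1`, `L = (n-1)!`) of
`ℂ[Δ_m(X₀₀^{m-n} per_n)]` are algebraically independent highest-weight vectors of the single weight
`seedWeight n m`. [folklore] -/
theorem twoRow_sameWeight_seeds [NeZero n] [NeZero m] (hn : 3 ≤ n) (hnm : n ≤ m) (hm : 2 ≤ m) :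
    ∃ F : Fin (n - 2) → OrbitCoordRing (paddedPerFormLex ℂ n m) m,
      (∀ k, F k ∈ highestWeightSpace (orbitCoordRep (paddedPerFormLex ℂ n m) m) (seedWeight n m hm)) ∧
      AlgebraicIndependent ℂ F := by
  classical
  set x : Fin (n - 1) → OrbitCoordRing (paddedPerFormLex ℂ n m) m := fun i =>
    Ideal.Quotient.mk (orbitVanishingIdeal (paddedPerFormLex ℂ n m) m) (twoRowHWV m hm (seedIdx i)) with hx
  refine ⟨fun k => (seedExp n k).prod fun i e => x i ^ e, fun k => ?_,
    algebraicIndependent_monomial x (algebraicIndependent_mk_twoRowHWV hn hnm hm) (seedExp n)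
      (seedExp_sum_injective hn)⟩
  -- the weight of the monomial
  have hk := k.2
  have hmon : ((seedExp n k).prod fun i e => x i ^ e) =
      x ⟨0, by omega⟩ ^ (seedL n / 2 - seedL n / (k + 2)) * x ⟨k + 1, by omega⟩ ^ (seedL n / (k + 2)) := by
    unfold seedExp
    rw [Finsupp.prod_add_index' (h := fun i e => x i ^ e) (fun _ => pow_zero _) (fun _ _ _ => pow_add _ _ _),
      Finsupp.prod_single_index (h := fun i e => x i ^ e) (pow_zero _),
      Finsupp.prod_single_index (h := fun i e => x i ^ e) (pow_zero _)]
  change ((seedExp n k).prod fun i e => x i ^ e) ∈ _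
  rw [hmon]
  have hw0 := pow_mem_highestWeightSpace_orbitCoordRep (paddedPerFormLex ℂ n m) m
    (mk_twoRowHWV_mem_highestWeightSpace hm (j := seedIdx (⟨0, by omega⟩ : Fin (n - 1))) (by
      rw [show seedIdx (⟨0, by omega⟩ : Fin (n - 1)) = 0 from seedIdx_zero]; omega) n)
    (seedL n / 2 - seedL n / (k + 2))
  have hwj := pow_mem_highestWeightSpace_orbitCoordRep (paddedPerFormLex ℂ n m) m
    (mk_twoRowHWV_mem_highestWeightSpace hm (j := seedIdx (⟨k + 1, by omega⟩ : Fin (n - 1))) (by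
      rw [show seedIdx (⟨k + 1, by omega⟩ : Fin (n - 1)) = k + 2 from seedIdx_of_ne_zero (by simp)]; omega) n)
    (seedL n / (k + 2))
  have hprod := mul_mem_highestWeightSpace_orbitCoordRep _ m hw0 hwj
  rw [show seedIdx (⟨0, by omega⟩ : Fin (n - 1)) = 0 from seedIdx_zero,
    show seedIdx (⟨k + 1, by omega⟩ : Fin (n - 1)) = k + 2 from seedIdx_of_ne_zero (by simp),
    seed_weight_eq hm (by omega) (by omega)] at hprod
  exact hprod

/-- **The stub shape** (cf. `stub_seedRichness` of line `big-cell-semigroup-floor`, with the richness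
`n⁴/4 ≤ D` replaced by the explicit two-row richness `D + 3 = n`): for all `n ≥ 4` and every `m ≥ n`,
the coordinate ring `ℂ[Δ_m(X₀₀^{m-n} per_n)]` contains `D + 1 = n - 2` ALGEBRAICALLY INDEPENDENT
highest-weight vectors of ONE weight — the explicit protomorph seeds of this file.  By the landed
engine `semigroupFloor` this yields `orbitMultiplicity ℂ (paddedPerFormLex ℂ n m) m (k • ν) ≥ C(k + n - 3, n - 3)`
for every `k`. [folklore] -/
theorem paddedPer_explicit_twoRow_seedRichness :
    ∀ n ≥ 4, ∀ (m : ℕ) [NeZero m], n ≤ m →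
      ∃ (ν : Weight (MatIdx m)) (D : ℕ) (F : Fin (D + 1) → OrbitCoordRing (paddedPerFormLex ℂ n m) m),
        D + 3 = n ∧
        (∀ i, F i ∈ highestWeightSpace (orbitCoordRep (paddedPerFormLex ℂ n m) m) ν) ∧
        AlgebraicIndependent ℂ F := by
  intro n hn m _ hnm
  haveI : NeZero n := ⟨by omega⟩
  have hm : 2 ≤ m := by omega
  obtain ⟨F, hF, hind⟩ := twoRow_sameWeight_seeds (n := n) (m := m) (by omega) hnm hm
  have hD : n - 3 + 1 = n - 2 := by omega
  refine ⟨seedWeight n m hm, n - 3, fun i => F (Fin.cast hD i), by omega, fun i => hF _, ?_⟩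
  exact hind.comp _ (Fin.cast_injective hD)

/-- **An explicit per-side multiplicity lower bound along a two-row ray** (the seeds fed to the landed
engine `semigroupFloor`): for `3 ≤ n ≤ m` and every `k`,
`orbitMultiplicity ℂ (paddedPerFormLex ℂ n m) m (k • seedWeight n m) ≥ C(k + n - 3, n - 3)` — the
multiplicities of the padded permanent grow at least like `k^{n-3}` along the ray of the explicit
two-row weight `seedWeight n m`, uniformly in `m`. [folklore] -/
theorem choose_le_orbitMultiplicity_paddedPer_twoRow_ray [NeZero n] [NeZero m] (hn : 3 ≤ n) (hnm : n ≤ m)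
    (hm : 2 ≤ m) (k : ℕ) :
    (k + (n - 3)).choose (n - 3) ≤ orbitMultiplicity ℂ (paddedPerFormLex ℂ n m) m (k • seedWeight n m hm) := by
  obtain ⟨F, hF, hind⟩ := twoRow_sameWeight_seeds (n := n) (m := m) hn hnm hm
  have hD : n - 3 + 1 = n - 2 := by omega
  exact semigroupFloor (paddedPerFormLex ℂ n m) (NeZero.ne m) (seedWeight n m hm) (n - 3)
    (fun i => F (Fin.cast hD i)) (fun i => hF _) (hind.comp _ (Fin.cast_injective hD)) k

end Seeds

end

end Summit.ValiantsHypothesis.ValiantsHypothesis.Theorems.ValuativeFlip
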